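import Mathlib.Analysis.SpecialFunctions.Pow.Integral
import Literature.Geometry.Lorentzian.RicciVariationScalarGlobal
import Literature.Geometry.Lorentzian.RicciVariationWeight
import Literature.Geometry.Lorentzian.RicciVariationUniformConstants
import Literature.Geometry.Lorentzian.RicciVariationConformalL6
import Literature.Geometry.Lorentzian.RicciChartDecay
import HarnessLib

/-!
# The conformal term of the mass derivative along `ds²_t = ds² + t Ric` is `O(t²)`
# (Schoen–Yau 1979, (3.27)–(3.30))

In the proof of Thm. 2 of Schoen–Yau (Comm. Math. Phys. 65 (1979), pp. 72–74) the mass of the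
scalar-flat metric `φ_t⁴ ds²_t` is `M(t) = −c ∫ R_t φ_t dV_t` (3.27), and `M'(0)` is computed by
differentiating under the integral sign (3.28)–(3.30). Writing `φ_t = 1 + v_t`, the integral splits
as `∫ R_t dV_t + ∫ R_t v_t dV_t`; this file proves that the second (conformal) term is `O(t²)`:

* `AFEnd.exists_bound_integral_scalarCurvature_mul_conformalFactor_sub_one` — there are
  `τ₄ ∈ (0, τ]` and `C_B ≥ 0` with `R_t (φ_t − 1) ∈ L¹(dV_t)` and
  `|∫ R_t (φ_t − 1) dV_t| ≤ C_B t²` for `|t| < τ₄`.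

Ingredients: `|R_t| ≤ |t| K (1 + ‖coord‖)⁻⁴` (`exists_abs_scalarCurvature_ricciFamily_sub_le`), the
uniform measure comparison and Sobolev constant along the family
(`exists_uniform_constants_ricciFamily`), the integrable weights (`RicciVariationWeight.lean`), the
`L⁶` bound for `v_t` (`integral_pow_six_conformalFactor_sub_one_le`: `‖v_t‖₆ ≲ ‖R_t‖_{6/5} = O(t)`
once `θ_t = c₁ ‖(R_t/8)₋‖_{3/2} ≤ ½`), and Hölder's inequality with exponents `6/5, 6`.
All results are proved; no definitions, no named facts.

## References

* R. Schoen, S.-T. Yau, Comm. Math. Phys. 65 (1979) 45–76, (3.27)–(3.30) (p. 73), Lemma 3.2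
  (3.5) (p. 65), Lemma 3.3 (pp. 71–72).
-/

noncomputable section

open Set Function Filter Metric Bornology Asymptotics MeasureTheory Measure TopologicalSpace
  Manifold Bundle
open scoped Topology Manifold ContDiff ENNReal

namespace Literature.Geometry.Lorentzian

open Literature.Geometry.Riemannian PseudoRiemannianMetric

namespace AFEnd

variable {X : Type} [TopologicalSpace X] [ChartedSpace E3 X] [IsManifold (𝓡 3) ∞ X]
  [T2Space X] [SecondCountableTopology X] [LocallyCompactSpace X] [ConnectedSpace X]
  [MeasurableSpace X] [BorelSpace X]
  (e : AFEnd X) (D : InitialDataSet (𝓡 3) X)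

/-- `((a)^{p}·b)^{1/p} = a · b^{1/p}` bookkeeping: for `a, b ≥ 0` and `p q` with `p * q = 1`,
`(a ^ p * b) ^ q = a * b ^ q`. [folklore] -/
private theorem rpow_mul_rpow_eq {a b p q : ℝ} (ha : 0 ≤ a) (hb : 0 ≤ b) (hpq : p * q = 1) :
    (a ^ p * b) ^ q = a * b ^ q := by
  rw [Real.mul_rpow (Real.rpow_nonneg ha _) hb, ← Real.rpow_mul ha, hpq, Real.rpow_one]

omit [T2Space X] [SecondCountableTopology X] [LocallyCompactSpace X] [ConnectedSpace X]
  [MeasurableSpace X] [BorelSpace X] in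
/-- The scalar curvatures of the family are continuous. [folklore] -/
private theorem continuous_scalarCurvatureFn' (D₂ : InitialDataSet (𝓡 3) X) :
    Continuous D₂.scalarCurvatureFn := by
  haveI := D₂.metric.hasLeviCivita
  exact D₂.metric.contMDiff_scalarCurvature.continuous.congr fun x ↦ (D₂.scalarCurvatureFn_eq x).symm

set_option maxHeartbeats 800000 in
-- a long measure-theoretic assembly
/-- **The conformal term is `O(t²)`** (Schoen–Yau 1979, (3.27)–(3.30) along `ds²_t`): for data `D`
with `R(h) ≡ 0` and `h − δ = o₅(r⁻²)` on the only end, a family `D_t` with metric `h + t Ric(h)`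
on `|t| < τ`, and positive factors `φ_t` with `φ_t⁴ h_t` (the metric of `D'_t`) scalar flat and
asymptotically Schwarzschildean, there are `τ₄ ∈ (0, τ]` and `C_B ≥ 0` such that for `|t| < τ₄`
the function `R_t (φ_t − 1)` is `dV_t`-integrable and `|∫ R_t (φ_t − 1) dV_t| ≤ C_B t²`
(`|R_t| ≤ |t| K W`, `‖φ_t − 1‖_{L⁶(dV_t)} ≤ 2 c₁ ‖R_t/8‖_{L^{6/5}(dV_t)}`, Hölder).
[cite: SchoenYauPMT1979, (3.27)–(3.30) (p. 73)] -/
theorem exists_bound_integral_scalarCurvature_mul_conformalFactor_sub_one [D.metric.HasLeviCivita]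
    (haf : e.IsStronglyAsymptoticallyFlatWith D 0 2 0 5 0) (hsole : e.IsSoleEnd)
    (hR0 : ∀ x : X, D.metric.scalarCurvature x = 0) {τ : ℝ} (hτ : 0 < τ)
    (Dt : ℝ → InitialDataSet (𝓡 3) X)
    (hval : ∀ t : ℝ, |t| < τ → ∀ (x : X) (v w : TangentSpace (𝓡 3) x),
      (Dt t).metric.val x v w = D.metric.val x v w + t * D.metric.ricci x v w)
    (φ : ℝ → X → ℝ) (D' : ℝ → InitialDataSet (𝓡 3) X) (m : ℝ → ℝ)
    (hsteps : ∀ t : ℝ, |t| < τ →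
      (∀ x, 0 < φ t x) ∧
      (∀ (x : X) (v w : TangentSpace (𝓡 3) x),
        (D' t).metric.val x v w = φ t x ^ 4 * (Dt t).metric.val x v w) ∧
      (∀ x, (D' t).scalarCurvatureFn x = 0) ∧
      IsAsymptoticallySchwarzschild e (D' t) (m t) 2) :
    ∃ τ₄ C_B : ℝ, 0 < τ₄ ∧ τ₄ ≤ τ ∧ 0 ≤ C_B ∧ ∀ t : ℝ, |t| < τ₄ →
      Integrable (fun x ↦ (Dt t).scalarCurvatureFn x * (φ t x - 1)) (riemannianMeasure (Dt t).h) ∧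
      |∫ x, (Dt t).scalarCurvatureFn x * (φ t x - 1) ∂riemannianMeasure (Dt t).h| ≤ C_B * t ^ 2 := by
  set μ : Measure X := riemannianMeasure D.h with hμ
  -- uniform constants along the family and the global curvature bound
  obtain ⟨τ₁, C, c₁, hτ₁, hτ₁τ, hC0, -, hc₁, -, hunif⟩ :=
    e.exists_uniform_constants_ricciFamily D haf hsole hτ Dt hval
  obtain ⟨τ₂, K, hτ₂, hτ₂τ, hK0, hglob⟩ :=
    e.exists_abs_scalarCurvature_ricciFamily_sub_le D haf hsole hτ Dt hval
  have hAF : e.IsMetricAsymptoticallyFlat D 2 :=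
    AFEnd.IsStronglyAsymptoticallyFlatWith.isMetricAsymptoticallyFlat_of_massZero e D haf
      (by norm_num)
  -- the weights
  set W : X → ℝ := fun x ↦ (1 + ‖e.coord x‖) ^ (-4 : ℝ) with hW
  have hW0 : ∀ x, 0 ≤ W x := fun x ↦ Real.rpow_nonneg (by positivity) _
  have hWpow : ∀ (p : ℝ) (x : X), W x ^ p = (1 + ‖e.coord x‖) ^ (-(4 * p)) := fun p x ↦ by
    rw [hW, ← Real.rpow_mul (by positivity)]
    ring_nf
  set J₁ : ℝ := ∫ x, (1 + ‖e.coord x‖) ^ (-(4 * (6 / 5 : ℝ))) ∂μ with hJ₁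
  set J₂ : ℝ := ∫ x, (1 + ‖e.coord x‖) ^ (-(4 * (3 / 2 : ℝ))) ∂μ with hJ₂
  have hJ₁0 : 0 ≤ J₁ := integral_nonneg fun x ↦ Real.rpow_nonneg (by positivity) _
  have hJ₂0 : 0 ≤ J₂ := integral_nonneg fun x ↦ Real.rpow_nonneg (by positivity) _
  clear_value J₁ J₂
  -- the time `τ₄`: also `θ_t ≤ 1/2`
  set A₀ : ℝ := c₁ * (K / 8) * (2 * J₂) ^ (2 / 3 : ℝ) with hA₀
  have hA₀0 : 0 ≤ A₀ := by positivity
  set τ₄ : ℝ := min (min τ₁ τ₂) (1 / (2 * (A₀ + 1))) with hτ₄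
  have hτ₄0 : 0 < τ₄ := lt_min (lt_min hτ₁ hτ₂) (by positivity)
  set C_B : ℝ := K * (2 * J₁) ^ (5 / 6 : ℝ) * (2 * c₁ * (K / 8) * (2 * J₁) ^ (5 / 6 : ℝ)) with hCB
  refine ⟨τ₄, C_B, hτ₄0, ((min_le_left _ _).trans (min_le_left _ _)).trans hτ₁τ, by positivity,
    fun t ht ↦ ?_⟩
  have ht₁ : |t| < τ₁ := ht.trans_le ((min_le_left _ _).trans (min_le_left _ _))
  have ht₂ : |t| < τ₂ := ht.trans_le ((min_le_left _ _).trans (min_le_right _ _))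
  have htτ : |t| < τ := ht₁.trans_le hτ₁τ
  have htA : A₀ * |t| ≤ 1 / 2 := by
    have h1 : |t| ≤ 1 / (2 * (A₀ + 1)) := ht.le.trans (min_le_right _ _)
    have h2 : A₀ * |t| ≤ A₀ * (1 / (2 * (A₀ + 1))) := mul_le_mul_of_nonneg_left h1 hA₀0
    have h3 : A₀ * (1 / (2 * (A₀ + 1))) ≤ 1 / 2 := by
      rw [mul_one_div, div_le_iff₀ (by positivity)]
      linarith
    exact h2.trans h3
  obtain ⟨-, hdens, -, hμle, -, hS⟩ := hunif t ht₁
  obtain ⟨hpos, hconf, hflat, hAS'⟩ := hsteps t htτ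
  set μt : Measure X := riemannianMeasure (Dt t).h with hμt
  set R : X → ℝ := (Dt t).scalarCurvatureFn with hR
  have hRc : Continuous R := continuous_scalarCurvatureFn' (Dt t)
  -- `|R_t| ≤ |t| K W`
  have hR00 : D.scalarCurvatureFn = fun _ ↦ 0 := by
    funext x
    rw [D.scalarCurvatureFn_eq]
    exact hR0 x
  have hRle : ∀ x, |R x| ≤ |t| * K * W x := fun x ↦ by
    have h := hglob t ht₂ x
    rw [hR00, sub_zero] at h
    exact h
  -- the weights are integrable for `dV_t`
  have hW65 : Integrable (fun x ↦ (1 + ‖e.coord x‖) ^ (-(4 * (6 / 5 : ℝ)))) μt :=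
    e.integrable_one_add_norm_coord_rpow_neg_of_le D two_pos hAF hsole (by norm_num) hμle
  have hW32 : Integrable (fun x ↦ (1 + ‖e.coord x‖) ^ (-(4 * (3 / 2 : ℝ)))) μt :=
    e.integrable_one_add_norm_coord_rpow_neg_of_le D two_pos hAF hsole (by norm_num) hμle
  -- integrals against `dV_t ≤ 2 dV`
  have hint_le : ∀ {f : X → ℝ}, (∀ x, 0 ≤ f x) → Integrable f μ →
      ∫ x, f x ∂μt ≤ 2 * ∫ x, f x ∂μ := by
    intro f hf0 hfi
    calc ∫ x, f x ∂μt ≤ ∫ x, f x ∂(ENNReal.ofReal 2 • μ) :=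
          integral_mono_measure hμle (Eventually.of_forall hf0) (hfi.smul_measure ENNReal.ofReal_ne_top)
      _ = 2 * ∫ x, f x ∂μ := by
          rw [integral_smul_measure, ENNReal.toReal_ofReal (by norm_num : (0 : ℝ) ≤ 2), smul_eq_mul]
  -- (a) `‖R/8‖_{6/5}` and `‖R‖_{6/5}`
  have hpow_le : ∀ (p : ℝ), 0 < p → ∀ (a : ℝ) (x : X), |R x * a| ^ p ≤
      (|t| * K * |a|) ^ p * (1 + ‖e.coord x‖) ^ (-(4 * p)) := by
    intro p hp a x
    rw [← hWpow, ← Real.mul_rpow (by positivity) (hW0 x)]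
    refine Real.rpow_le_rpow (abs_nonneg _) ?_ hp.le
    rw [abs_mul]
    calc |R x| * |a| ≤ |t| * K * W x * |a| := mul_le_mul_of_nonneg_right (hRle x) (abs_nonneg a)
      _ = |t| * K * |a| * W x := by ring
  have hint_pow : ∀ (p : ℝ), 3 / 4 < p → Integrable (fun x ↦ (1 + ‖e.coord x‖) ^ (-(4 * p))) μt →
      ∀ a : ℝ, Integrable (fun x ↦ |R x * a| ^ p) μt ∧
        ∫ x, |R x * a| ^ p ∂μt ≤ (|t| * K * |a|) ^ p * (2 * ∫ x, (1 + ‖e.coord x‖) ^ (-(4 * p)) ∂μ) := by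
    intro p hp34 hWi a
    have hp : 0 < p := by linarith
    have hmeas : AEStronglyMeasurable (fun x ↦ |R x * a| ^ p) μt :=
      ((hRc.mul continuous_const).abs.rpow_const fun x ↦ Or.inr hp.le).aestronglyMeasurable
    have hdom : Integrable (fun x ↦ (|t| * K * |a|) ^ p * (1 + ‖e.coord x‖) ^ (-(4 * p))) μt :=
      hWi.const_mul _
    have hi : Integrable (fun x ↦ |R x * a| ^ p) μt := by
      refine hdom.mono' hmeas (Eventually.of_forall fun x ↦ ?_)
      rw [Real.norm_of_nonneg (Real.rpow_nonneg (abs_nonneg _) _)]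
      exact hpow_le p hp a x
    refine ⟨hi, ?_⟩
    have hWμ : Integrable (fun x ↦ (1 + ‖e.coord x‖) ^ (-(4 * p))) μ :=
      e.integrable_one_add_norm_coord_rpow_neg D two_pos hAF hsole (by nlinarith)
    calc ∫ x, |R x * a| ^ p ∂μt ≤ ∫ x, (|t| * K * |a|) ^ p * (1 + ‖e.coord x‖) ^ (-(4 * p)) ∂μt :=
          integral_mono hi hdom fun x ↦ hpow_le p hp a x
      _ = (|t| * K * |a|) ^ p * ∫ x, (1 + ‖e.coord x‖) ^ (-(4 * p)) ∂μt := integral_const_mul _ _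
      _ ≤ (|t| * K * |a|) ^ p * (2 * ∫ x, (1 + ‖e.coord x‖) ^ (-(4 * p)) ∂μ) :=
          mul_le_mul_of_nonneg_left (hint_le (fun x ↦ Real.rpow_nonneg (by positivity) _) hWμ)
            (Real.rpow_nonneg (by positivity) _)
  -- (b) the negative part of `R/8` in `L^{3/2}` and `θ_t ≤ 1/2`
  obtain ⟨hi32, hle32⟩ := hint_pow (3 / 2) (by norm_num) hW32 8⁻¹
  obtain ⟨hi65, hle65⟩ := hint_pow (6 / 5) (by norm_num) hW65 8⁻¹
  obtain ⟨hi65', hle65'⟩ := hint_pow (6 / 5) (by norm_num) hW65 1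
  have habs8 : |(8 : ℝ)⁻¹| = 8⁻¹ := abs_of_pos (by norm_num)
  have hdiv : ∀ x, R x / 8 = R x * 8⁻¹ := fun x ↦ div_eq_mul_inv _ _
  set fm : X → ℝ := fun x ↦ max (-(R x / 8)) 0 with hfm
  have hfm0 : ∀ x, 0 ≤ fm x := fun x ↦ le_max_right _ _
  have hfmle : ∀ x, fm x ^ (3 / 2 : ℝ) ≤ |R x * 8⁻¹| ^ (3 / 2 : ℝ) := fun x ↦ by
    refine Real.rpow_le_rpow (hfm0 x) ?_ (by norm_num)
    rw [← hdiv]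
    exact max_le (neg_le_abs _) (abs_nonneg _)
  have hfmc : Continuous fm := (hRc.div_const 8).neg.max continuous_const
  have hfi : Integrable (fun x ↦ max (-((Dt t).scalarCurvatureFn x / 8)) 0 ^ (3 / 2 : ℝ)) μt := by
    refine hi32.mono' ((hfmc.rpow_const fun x ↦ Or.inr (by norm_num)).aestronglyMeasurable)
      (Eventually.of_forall fun x ↦ ?_)
    rw [Real.norm_of_nonneg (Real.rpow_nonneg (hfm0 x) _)]
    exact hfmle x
  have hθint : ∫ x, max (-((Dt t).scalarCurvatureFn x / 8)) 0 ^ (3 / 2 : ℝ) ∂μt ≤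
      (|t| * K * 8⁻¹) ^ (3 / 2 : ℝ) * (2 * J₂) := by
    refine (integral_mono hfi hi32 fun x ↦ hfmle x).trans ?_
    rw [habs8, ← hJ₂] at hle32
    exact hle32
  have hθint0 : 0 ≤ ∫ x, max (-((Dt t).scalarCurvatureFn x / 8)) 0 ^ (3 / 2 : ℝ) ∂μt :=
    integral_nonneg fun x ↦ Real.rpow_nonneg (hfm0 x) _
  have hθle : c₁ * (∫ x, max (-((Dt t).scalarCurvatureFn x / 8)) 0 ^ (3 / 2 : ℝ) ∂μt) ^ (2 / 3 : ℝ) ≤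
      1 / 2 := by
    have h1 : (∫ x, max (-((Dt t).scalarCurvatureFn x / 8)) 0 ^ (3 / 2 : ℝ) ∂μt) ^ (2 / 3 : ℝ) ≤
        ((|t| * K * 8⁻¹) ^ (3 / 2 : ℝ) * (2 * J₂)) ^ (2 / 3 : ℝ) :=
      Real.rpow_le_rpow hθint0 hθint (by norm_num)
    rw [rpow_mul_rpow_eq (a := |t| * K * 8⁻¹) (b := 2 * J₂) (p := 3 / 2) (q := 2 / 3) (by positivity)
      (by positivity) (by norm_num)] at h1
    calc c₁ * (∫ x, max (-((Dt t).scalarCurvatureFn x / 8)) 0 ^ (3 / 2 : ℝ) ∂μt) ^ (2 / 3 : ℝ)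
        ≤ c₁ * (|t| * K * 8⁻¹ * (2 * J₂) ^ (2 / 3 : ℝ)) := mul_le_mul_of_nonneg_left h1 hc₁
      _ = A₀ * |t| := by simp only [hA₀]; ring
      _ ≤ 1 / 2 := htA
  have hθlt : c₁ * (∫ x, max (-((Dt t).scalarCurvatureFn x / 8)) 0 ^ (3 / 2 : ℝ) ∂μt) ^ (2 / 3 : ℝ) <
      1 := hθle.trans_lt (by norm_num)
  -- (c) `R/8 ∈ L^{6/5}`
  have hgi : Integrable (fun x ↦ |(Dt t).scalarCurvatureFn x / 8| ^ (6 / 5 : ℝ)) μt := by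
    refine hi65.congr (Eventually.of_forall fun x ↦ ?_)
    change |R x * 8⁻¹| ^ (6 / 5 : ℝ) = |R x / 8| ^ (6 / 5 : ℝ)
    rw [hdiv]
  have hgint : ∫ x, |(Dt t).scalarCurvatureFn x / 8| ^ (6 / 5 : ℝ) ∂μt ≤
      (|t| * K * 8⁻¹) ^ (6 / 5 : ℝ) * (2 * J₁) := by
    have h : ∫ x, |(Dt t).scalarCurvatureFn x / 8| ^ (6 / 5 : ℝ) ∂μt = ∫ x, |R x * 8⁻¹| ^ (6 / 5 : ℝ) ∂μt :=
      integral_congr_ae (Eventually.of_forall fun x ↦ by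
        change |R x / 8| ^ (6 / 5 : ℝ) = |R x * 8⁻¹| ^ (6 / 5 : ℝ)
        rw [hdiv])
    rw [h]
    rw [habs8, ← hJ₁] at hle65
    exact hle65
  have hgint0 : 0 ≤ ∫ x, |(Dt t).scalarCurvatureFn x / 8| ^ (6 / 5 : ℝ) ∂μt :=
    integral_nonneg fun x ↦ Real.rpow_nonneg (abs_nonneg _) _
  -- (d) the `L⁶` bound for `v = φ_t − 1`
  haveI := (Dt t).metric.hasLeviCivita
  have hASt : IsAsymptoticallySchwarzschild e (Dt t) 0 2 :=
    e.isAsymptoticallySchwarzschild_of_metric_eq_add_ricci D haf (hval t htτ)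
  have hAFt : e.IsMetricAsymptoticallyFlat (Dt t) 2 := hASt.isMetricAsymptoticallyFlat_two le_rfl
  obtain ⟨hv6i, hv6le⟩ := e.integral_pow_six_conformalFactor_sub_one_le (Dt t) two_pos hAFt hsole
    hc₁ hS hASt hAS' hpos hconf hflat hfi hθlt hgi
  set V : ℝ := 2 * c₁ * (|t| * K * 8⁻¹) * (2 * J₁) ^ (5 / 6 : ℝ) with hV
  have hV0 : 0 ≤ V := by positivity
  have hv6le' : ∫ x, |φ t x - 1| ^ 6 ∂μt ≤ V ^ 6 := by
    refine hv6le.trans (pow_le_pow_left₀ ?_ ?_ 6)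
    · exact div_nonneg (mul_nonneg hc₁ (Real.rpow_nonneg hgint0 _)) (by linarith)
    · rw [div_le_iff₀ (by linarith)]
      have h1 : (∫ x, |(Dt t).scalarCurvatureFn x / 8| ^ (6 / 5 : ℝ) ∂μt) ^ (5 / 6 : ℝ) ≤
          ((|t| * K * 8⁻¹) ^ (6 / 5 : ℝ) * (2 * J₁)) ^ (5 / 6 : ℝ) :=
        Real.rpow_le_rpow hgint0 hgint (by norm_num)
      rw [rpow_mul_rpow_eq (a := |t| * K * 8⁻¹) (b := 2 * J₁) (p := 6 / 5) (q := 5 / 6) (by positivity)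
        (by positivity) (by norm_num)] at h1
      have h2 : c₁ * (∫ x, |(Dt t).scalarCurvatureFn x / 8| ^ (6 / 5 : ℝ) ∂μt) ^ (5 / 6 : ℝ) ≤
          c₁ * (|t| * K * 8⁻¹ * (2 * J₁) ^ (5 / 6 : ℝ)) := mul_le_mul_of_nonneg_left h1 hc₁
      have h3 : 1 / 2 ≤ 1 - c₁ * (∫ x, max (-((Dt t).scalarCurvatureFn x / 8)) 0 ^ (3 / 2 : ℝ) ∂μt) ^
          (2 / 3 : ℝ) := by linarith
      calc c₁ * (∫ x, |(Dt t).scalarCurvatureFn x / 8| ^ (6 / 5 : ℝ) ∂μt) ^ (5 / 6 : ℝ)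
          ≤ c₁ * (|t| * K * 8⁻¹ * (2 * J₁) ^ (5 / 6 : ℝ)) := h2
        _ = V * (1 / 2) := by simp only [hV]; ring
        _ ≤ V * (1 - c₁ * (∫ x, max (-((Dt t).scalarCurvatureFn x / 8)) 0 ^ (3 / 2 : ℝ) ∂μt) ^
              (2 / 3 : ℝ)) := mul_le_mul_of_nonneg_left h3 hV0
  -- (e) Hölder with exponents `6/5, 6`
  have hφc : Continuous fun x ↦ φ t x - 1 :=
    (contMDiff_conformalFactor (Dt t).metric (D' t).metric (Dt t).isRiemannian_metric hpos
      hconf).continuous.sub continuous_const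
  have hpq : (6 / 5 : ℝ).HolderConjugate 6 := Real.holderConjugate_iff.2 ⟨by norm_num, by norm_num⟩
  have hRi65 : Integrable (fun x ↦ |R x| ^ (6 / 5 : ℝ)) μt := by
    refine hi65'.congr (Eventually.of_forall fun x ↦ ?_)
    simp only [mul_one]
  have hRint65 : ∫ x, |R x| ^ (6 / 5 : ℝ) ∂μt ≤ (|t| * K) ^ (6 / 5 : ℝ) * (2 * J₁) := by
    have h : ∫ x, |R x| ^ (6 / 5 : ℝ) ∂μt = ∫ x, |R x * 1| ^ (6 / 5 : ℝ) ∂μt :=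
      integral_congr_ae (Eventually.of_forall fun x ↦ by simp only [mul_one])
    rw [h]
    rw [abs_one, mul_one, ← hJ₁] at hle65'
    exact hle65'
  have hRLp : MemLp (fun x ↦ |R x|) (ENNReal.ofReal (6 / 5)) μt := by
    refine (integrable_norm_rpow_iff (μ := μt) hRc.abs.aestronglyMeasurable
      (p := ENNReal.ofReal (6 / 5)) (by simp) (by simp)).1 ?_
    rw [ENNReal.toReal_ofReal (by norm_num : (0 : ℝ) ≤ 6 / 5)]
    refine hRi65.congr (Eventually.of_forall fun x ↦ ?_)
    simp only [Real.norm_eq_abs, abs_abs]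
  have hv6i' : Integrable (fun x ↦ |φ t x - 1| ^ (6 : ℝ)) μt := by
    refine hv6i.congr (Eventually.of_forall fun x ↦ ?_)
    simp only
    norm_cast
  have hvLp : MemLp (fun x ↦ |φ t x - 1|) (ENNReal.ofReal 6) μt := by
    refine (integrable_norm_rpow_iff (μ := μt) hφc.abs.aestronglyMeasurable
      (p := ENNReal.ofReal 6) (by simp) (by simp)).1 ?_
    rw [ENNReal.toReal_ofReal (by norm_num : (0 : ℝ) ≤ 6)]
    refine hv6i'.congr (Eventually.of_forall fun x ↦ ?_)
    simp only [Real.norm_eq_abs, abs_abs]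
  have hholder : ∫ x, |R x| * |φ t x - 1| ∂μt ≤
      (∫ x, |R x| ^ (6 / 5 : ℝ) ∂μt) ^ (1 / (6 / 5 : ℝ)) * (∫ x, |φ t x - 1| ^ (6 : ℝ) ∂μt) ^ (1 / (6 : ℝ)) :=
    integral_mul_le_Lp_mul_Lq_of_nonneg hpq (Eventually.of_forall fun x ↦ abs_nonneg _)
      (Eventually.of_forall fun x ↦ abs_nonneg _) hRLp hvLp
  -- (f) integrability of `R_t (φ_t − 1)` (Young's inequality) and the final bound
  have hprod : Integrable (fun x ↦ (Dt t).scalarCurvatureFn x * (φ t x - 1)) μt := by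
    have hbd : Integrable (fun x ↦ |R x| ^ (6 / 5 : ℝ) / (6 / 5) + |φ t x - 1| ^ (6 : ℝ) / 6) μt :=
      (hRi65.div_const _).add (hv6i'.div_const _)
    refine hbd.mono' ((hRc.mul hφc).aestronglyMeasurable) (Eventually.of_forall fun x ↦ ?_)
    rw [Real.norm_eq_abs, abs_mul]
    have h := Real.young_inequality |R x| |φ t x - 1| hpq
    simp only [abs_abs] at h
    exact h
  refine ⟨hprod, ?_⟩
  have h6 : (∫ x, |φ t x - 1| ^ (6 : ℝ) ∂μt) ^ (1 / (6 : ℝ)) ≤ V := by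
    have hint6 : ∫ x, |φ t x - 1| ^ (6 : ℝ) ∂μt = ∫ x, |φ t x - 1| ^ 6 ∂μt :=
      integral_congr_ae (Eventually.of_forall fun x ↦ by simp only; norm_cast)
    rw [hint6]
    have h0 : 0 ≤ ∫ x, |φ t x - 1| ^ 6 ∂μt := integral_nonneg fun x ↦ by positivity
    calc (∫ x, |φ t x - 1| ^ 6 ∂μt) ^ (1 / (6 : ℝ)) ≤ (V ^ 6) ^ (1 / (6 : ℝ)) :=
          Real.rpow_le_rpow h0 hv6le' (by norm_num)
      _ = V := by
          rw [show (V ^ 6 : ℝ) = V ^ ((6 : ℕ) : ℝ) by norm_cast, ← Real.rpow_mul hV0]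
          norm_num
  have h65 : (∫ x, |R x| ^ (6 / 5 : ℝ) ∂μt) ^ (1 / (6 / 5 : ℝ)) ≤ |t| * K * (2 * J₁) ^ (5 / 6 : ℝ) := by
    have h0 : 0 ≤ ∫ x, |R x| ^ (6 / 5 : ℝ) ∂μt := integral_nonneg fun x ↦ Real.rpow_nonneg (abs_nonneg _) _
    have h1 : (∫ x, |R x| ^ (6 / 5 : ℝ) ∂μt) ^ (5 / 6 : ℝ) ≤ ((|t| * K) ^ (6 / 5 : ℝ) * (2 * J₁)) ^ (5 / 6 : ℝ) :=
      Real.rpow_le_rpow h0 hRint65 (by norm_num)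
    rw [rpow_mul_rpow_eq (a := |t| * K) (b := 2 * J₁) (p := 6 / 5) (q := 5 / 6) (by positivity)
      (by positivity) (by norm_num)] at h1
    rw [show (1 / (6 / 5 : ℝ)) = 5 / 6 by norm_num]
    exact h1
  calc |∫ x, (Dt t).scalarCurvatureFn x * (φ t x - 1) ∂μt|
      ≤ ∫ x, |(Dt t).scalarCurvatureFn x * (φ t x - 1)| ∂μt := abs_integral_le_integral_abs
    _ = ∫ x, |R x| * |φ t x - 1| ∂μt := integral_congr_ae (Eventually.of_forall fun x ↦ abs_mul _ _)
    _ ≤ (∫ x, |R x| ^ (6 / 5 : ℝ) ∂μt) ^ (1 / (6 / 5 : ℝ)) *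
          (∫ x, |φ t x - 1| ^ (6 : ℝ) ∂μt) ^ (1 / (6 : ℝ)) := hholder
    _ ≤ (|t| * K * (2 * J₁) ^ (5 / 6 : ℝ)) * V :=
        mul_le_mul h65 h6 (Real.rpow_nonneg (integral_nonneg fun x ↦ Real.rpow_nonneg (abs_nonneg _) _) _)
          (by positivity)
    _ = C_B * |t| ^ 2 := by simp only [hV, hCB]; ring
    _ = C_B * t ^ 2 := by rw [sq_abs]

end AFEnd

end Literature.Geometry.Lorentzian

end
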